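import Mathlib
import Summits.AtomisticToContinuum.Crystallization.Theses.TwoCentreKissingKernel
import Summits.AtomisticToContinuum.Crystallization.Theses.LaminarSixThreeThree
import Summits.AtomisticToContinuum.Crystallization.Theorems.LaminarSixThreeThreeLaminarToBarlow
import Summits.AtomisticToContinuum.Crystallization.Theorems.LaminarSixThreeThreeBarlowToHcpWindows
import Summits.AtomisticToContinuum.Crystallization.Theorems.LaminarSixThreeThreeHcpWindowsToPeriodicWindows

/-!
# Birth skeleton — crux `TwoCentreKissingKernel.ClosePackedCrystallizes` (stmt-AtomisticToContinuum-12080)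

Route `route-AtomisticToContinuum-TwoCentreKissingKernel` (rank-5 crux, the HINGE), sub-problem
`Crystallization`; crux workfile `Cruxes/ClosePackedCrystallizes/Lines/birth.lean` (BC3 skeleton,
registered with `ledger skeleton check`).

The crux (FIXED, the route's decl and signature):
`ClosePackedCrystallizes : LocalClosePacking → IsCrystallizing lennardJones 3` — if Lennard-Jones ground
states are locally close-packed almost everywhere (one bond length `a > 0`; all but `o(N)` particles
have their soft first shell, radius `(1 + 10⁻³)a`, `1/10`-close after a linear isometry to the FCC or
the HCP kissing pattern), then ground states converge locally, along a subsequence and up to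
translations, to a non-zero lattice-periodic configuration (Blanc–Lewin (15)–(17)).

What the refuter's crux attack settled (evidence `Evidence12080.lean`, 2026-08-15): the crux is implied
by conjunct (ii) of the summit with its hypothesis unused (`of_conjunct_ii`), and its GEOMETRIC SHADOW
IS FALSE (`geometric_shadow_false`: the tree's `spikeHagg` stacking has exact FCC/HCP shells everywhere
and is not the point set of any `PeriodicConfiguration`) — the content of the hinge is ENERGETIC:
sharpening of the coarse close-packed shells and STACKING SELECTION.  The catalogued barriers say the
same: `Literature.Barriers.AtomisticToContinuum.KissingTwelveDegeneracy` (twelve FCC/HCP contacts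
determine the hexagonal layers, never the Hägg walk) and
`Literature.Barriers.AtomisticToContinuum.ShortRangeStackingBlindness` (a potential of range `< √(8/3)`
cannot select the walk; Lennard-Jones has infinite range, so the selection must come from the
`r⁻⁶` tail inside GROUND STATES).

## The line (the route's own two-layer plan "SoftLayering → StackingSelection", typed over the vetted
vocabulary of route `LaminarSixThreeThree`, whose counting / compactness / hull glues are PROVED)

Three registered stubs, each a genuine lemma of the line, none a restatement of the crux or of the
summit (BC3 probes `stub → ClosePackedCrystallizes`, `stub → Crystallization` by
`first | exact? | simpa | aesop` all FAIL — folder `bc/probe_*.lean`):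

* `stub_goodWindows : LocalClosePacking → GoodWindowsAE` (NEW; ENERGY I + combinatorial layering; XL).
  Close-packed shells a.e. ⇒ GOOD laminar windows a.e.: for every `R ≥ 2`, `ε > 0`, all but `o(N)`
  particles have an `(R, ε)`-window with two bond lengths `a` (in-plane), `b` (inter-layer) in
  `[19/20, 1]`, a unit normal, `ε`-flat levels with gaps `≥ 19/25`, separation `≥ 19/20`, and exactly
  `6 + 3 + 3` `ε`-sharp bonds at every particle of the half-window (verbatim the consequent of
  `LaminarSixThreeThree.LaminarSaturation`, stmt-14294).  Under `LocalClosePacking` the particles are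
  ALREADY twelve-coordinated in FCC/HCP arrangement a.e., so — unlike `LaminarSaturation` — no kissing
  cap and no saturation step is needed: the content is (i) COMBINATORIAL LAYERING of an all-good
  window (`1/10`-close FCC/HCP shells at every particle of a window ⇒ one coherent family of
  hexagonal layers with the `6 + 3 + 3` adjacency: the soft form of the PROVED
  `HalesDSP_layerPackings_holds` / `BrittleRungDescent.SoftLayerPropagation`; windows met by two
  non-parallel fault planes contain bad particles on the junction line, and the spoiling count uses
  the PROVED `LennardJonesMinimalDistance_holds`), and (ii) SHARPENING by the energy: flatness of the
  layers and `ε`-sharpness of the two bond lengths away from `o(N)` particles (trial bound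
  `E(N) ≤ N·e(hcp) + O(N^{2/3})`, convexity of `V_LJ` at the bond scale, elastic decay away from the
  `o(N)` defects).  TWO lengths `(a, b)` and free level gaps are essential: the relaxed LJ hcp has a
  bond split `~10⁻⁴`, so every single-scale sharp statement (`ShellCloseTo η`, `η → 0`, to the IDEAL
  patterns) is false — this is why the sharpening cannot be phrased inside the kernel's own
  `ShellCloseTo` vocabulary.
* `stub_rigidity : LaminarSixThreeThree.LaminarRigidity` (= stmt-14295 verbatim, SHARED; pure geometry;
  L).  A GOOD `(R, ε)`-window (`R ≥ 16`, `ε ≤ 10⁻³`) is two-way `C(R)·ε`-matched on radius `R/4`, after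
  a rigid motion, to SOME Barlow stacking `barlowStacking a h s` (`a, h ∈ (1/2, 2)`, `s` Hägg).
* `stub_stackingSelection : LaminarSixThreeThree.LaminarBarlowWindows → LaminarSixThreeThree.StackingFaultSparsity`
  (ENERGY II, the selection proper; weaker than the shared item stmt-14296, which it has as
  consequent; XL).  Given Barlow windows a.e. AT EVERY SCALE in LJ ground states, the windows matched
  to some Barlow stacking but to no `hcpStacking a h` are `o(N)` (Hägg domination
  `|J₂| > Σ_{k ≥ 3} k|J_k|` with certified couplings against the `O(N^{2/3})` surface budget — items
  0716 / 0737 / 0670 of the summit —, or truncation + Radin–Schulman periodicity).  DISPROOF USED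
  (crux 14296, `Cruxes/StackingFaultSparsity/Disproof.lean`, landed as
  `Theorems/StackingFaultSparsity/Negative/*`): the stub honours
  `stackingFaultSparsity_false_without_groundState` (H = `IsGroundState` is kept on both sides) and is
  NOT the refuted same-scale, potential-free transfer `SameScaleBarlowToHcp`
  (`not_sameScaleBarlowToHcp`): its hypothesis gives Barlow order at ALL scales and the statement never
  leaves ground states, exactly the shape the disprover's note S1/§4/§6 prescribes.

Composition (sorry-free, NOT a one-line seam): `barlowWindows_of_goodWindows` turns GOOD windows a.e.
+ laminar rigidity into Barlow windows a.e. (= `LaminarBarlowWindows`) by the tolerance bookkeeping of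
the landed glue `laminarToBarlow_proof`, re-proved here from its weakest hypothesis (`GoodWindowsAE`
instead of `LjLaminarity ∧ LaminarSaturation`); then the three PROVED glues of `LaminarSixThreeThree` —
`barlowToHcpWindows_proof` (counting), `hcpWindowsToPeriodicWindows_proof` (compactness over
`(R_k, ε_k) = (k, 1/k)`, HCP homogeneity), `HullCriterion_holds` (hull criterion: periodic windows ⇒
`IsCrystallizing`, using the PROVED `LennardJonesMinimalDistance_holds`) — give
`IsCrystallizing lennardJones 3`.  `ClosePackedCrystallizes_of_stubs : stub₁ → stub₂ → stub₃ → (body of the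
crux)` is the explicit implication; `ClosePackedCrystallizes_of : TwoCentreKissingKernel.ClosePackedCrystallizes`
concludes the route decl BY NAME from the three stubs (the only theorem concluding it; sorries only inside
`stub_*`).

Dead lines on this crux: none recorded (no `Disproof.lean`, no earlier `Lines/*`).  Hardest stub:
`stub_stackingSelection` (stacking selection for Lennard-Jones, open; shared fate with crux 14296).
-/

noncomputable section

namespace Summit.AtomisticToContinuum.Crystallization.Cruxes.ClosePackedCrystallizes.Birth

open Literature.MathematicalPhysics.StatisticalMechanics
open Summit.AtomisticToContinuum.Crystallization.Theses.LaminarSixThreeThree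
  (LaminarBarlowWindows LaminarRigidity StackingFaultSparsity HullCriterion_holds)
open Summit.AtomisticToContinuum.Crystallization.Theses.TwoCentreKissingKernel
  (LocalClosePacking ClosePackedCrystallizes)
open Summit.AtomisticToContinuum.Crystallization.Theorems
  (barlowToHcpWindows_proof hcpWindowsToPeriodicWindows_proof laminarToBarlow_tolerance)

/-- Ambient space `ℝ³`. -/
abbrev E3 := EuclideanSpace ℝ (Fin 3)

/-! ## Named predicates (verbatim clauses of the `LaminarSixThreeThree` decls; used by the composition —
the registered stub signatures below are spelled out over route declarations only) -/

/-- GOOD `(R, ε)`-window at site `i` (verbatim the clause negated inside `LaminarSaturation` and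
assumed by `LaminarRigidity`): bond lengths `a` (in-plane), `b` (inter-layer) in `[19/20, 1]`, a unit
normal `n`, levels `c` with gaps `≥ 19/25`, a level index `l` with every particle within `R` of `x i`
within `ε` of its level, pairwise separation `≥ 19/20` on the window, and for every `j` within `R/2`
of `x i` exactly `6` same-level, `3` level-up and `3` level-down particles within distance `1`, each
bond `ε`-close to `a` resp. `b`. -/
def GoodWindow (R ε : ℝ) {N : ℕ} (x : Fin N → E3) (i : Fin N) : Prop :=
  ∃ a b : ℝ, 19 / 20 ≤ a ∧ a ≤ 1 ∧ 19 / 20 ≤ b ∧ b ≤ 1 ∧ ∃ n : EuclideanSpace ℝ (Fin 3), ‖n‖ = 1 ∧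
    ∃ c : ℤ → ℝ, (∀ k : ℤ, c k + 19 / 25 ≤ c (k + 1)) ∧ ∃ l : Fin N → ℤ,
      (∀ j : Fin N, dist (x j) (x i) ≤ R → |inner ℝ (x j - x i) n - c (l j)| ≤ ε) ∧
      (∀ j k : Fin N, dist (x j) (x i) ≤ R → dist (x k) (x i) ≤ R → j ≠ k → 19 / 20 ≤ dist (x j) (x k)) ∧
      ∀ j : Fin N, dist (x j) (x i) ≤ R / 2 →
        Nat.card {k : Fin N // k ≠ j ∧ l k = l j ∧ dist (x j) (x k) ≤ 1} = 6 ∧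
        Nat.card {k : Fin N // l k = l j + 1 ∧ dist (x j) (x k) ≤ 1} = 3 ∧
        Nat.card {k : Fin N // l k = l j - 1 ∧ dist (x j) (x k) ≤ 1} = 3 ∧
        ∀ k : Fin N, k ≠ j → dist (x j) (x k) ≤ 1 →
          (l k = l j → |dist (x j) (x k) - a| ≤ ε) ∧ (l k ≠ l j → |dist (x j) (x k) - b| ≤ ε)

/-- BARLOW-MATCHED `(R, δ)`-window at site `i` (verbatim the clause negated inside
`LaminarBarlowWindows`): the `R`-window of `x i` is two-way `δ`-matched, after a linear isometry `A`,
to the `R`-window of a point `z` of some Barlow stacking `barlowStacking a h s` (`a, h ∈ (1/2, 2)`,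
`s` a Hägg sequence). -/
def BarlowMatched (R δ : ℝ) {N : ℕ} (x : Fin N → E3) (i : Fin N) : Prop :=
  ∃ a h : ℝ, 1 / 2 < a ∧ a < 2 ∧ 1 / 2 < h ∧ h < 2 ∧ ∃ s : ℤ → ℤ, IsHaggSeq s ∧
    ∃ z ∈ barlowStacking a h s, ∃ A : EuclideanSpace ℝ (Fin 3) →ₗᵢ[ℝ] EuclideanSpace ℝ (Fin 3),
      (∀ p ∈ barlowStacking a h s, dist p z ≤ R → ∃ j : Fin N, dist (x j) (x i + A (p - z)) ≤ δ) ∧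
      (∀ j : Fin N, dist (x j) (x i) ≤ R → ∃ p ∈ barlowStacking a h s, dist (x j) (x i + A (p - z)) ≤ δ)

/-- GOOD WINDOWS ALMOST EVERYWHERE (the consequent of `LaminarSaturation`): for every `R ≥ 2`, `ε > 0`
and every sequence of Lennard-Jones ground states the fraction of particles without a GOOD
`(R, ε)`-window tends to `0`. -/
def GoodWindowsAE : Prop :=
  ∀ R ε : ℝ, 2 ≤ R → 0 < ε → ∀ x : (N : ℕ) → (Fin N → E3),
    (∀ N, IsGroundState lennardJones (x N)) →
      Filter.Tendsto (fun N : ℕ => (Nat.card {i : Fin N // ¬ GoodWindow R ε (x N) i} : ℝ) / N)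
        Filter.atTop (nhds 0)

/-- The statement of stub 1, named: close packing a.e. ⇒ GOOD windows a.e. -/
def ClosePackedGoodWindows : Prop :=
  LocalClosePacking → GoodWindowsAE

/-- The statement of stub 3, named: Barlow windows a.e. (all scales) ⇒ stacking-fault sparsity. -/
def StackingSelection : Prop :=
  LaminarBarlowWindows → StackingFaultSparsity

/-- The crux through its two constants (definitional unfolding). -/
theorem crux_iff :
    ClosePackedCrystallizes ↔ (LocalClosePacking → IsCrystallizing lennardJones 3) :=
  Iff.rfl

/-- `LaminarBarlowWindows` through the named predicate (definitional unfolding). -/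
theorem barlowWindows_iff :
    LaminarBarlowWindows ↔
      ∀ R ε : ℝ, 0 < R → 0 < ε → ε < 1 / 4 → ∀ x : (N : ℕ) → (Fin N → E3),
        (∀ N, IsGroundState lennardJones (x N)) →
          Filter.Tendsto (fun N : ℕ => (Nat.card {i : Fin N // ¬ BarlowMatched R ε (x N) i} : ℝ) / N)
            Filter.atTop (nhds 0) :=
  Iff.rfl

/-- `LaminarRigidity` through the named predicates: a GOOD `(R, ε)`-window is Barlow-matched at
`(R/4, C R * ε)`. -/
theorem rigidity_iff :
    LaminarRigidity ↔
      ∃ C : ℝ → ℝ, ∀ R ε : ℝ, 16 ≤ R → 0 < ε → ε ≤ 1 / 1000 →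
        ∀ (N : ℕ) (x : Fin N → E3) (i : Fin N), GoodWindow R ε x i → BarlowMatched (R / 4) (C R * ε) x i :=
  Iff.rfl

/-! ## The stubs (registered obligations; signatures over route declarations only) -/

/-- **Stub 1 — CLOSE PACKING ⇒ GOOD LAMINAR WINDOWS a.e.** (NEW; energy + combinatorial layering;
size XL).  `LocalClosePacking →` [verbatim consequent of `LaminarSixThreeThree.LaminarSaturation`]:
for every `R ≥ 2`, `ε > 0` and every sequence of LJ ground states, all but `o(N)` particles have a GOOD
`(R, ε)`-window.  Why plausibly true: a.e. particle is FCC/HCP-coordinated (hypothesis), an all-good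
window is combinatorially a coherent stack of hexagonal layers (soft Hales layer lemma; junctions of
non-parallel faults are bad particles, `o(N)` by the spoiling count with the PROVED minimal distance),
and ground-state energetics make the layers `ε`-flat and the two bond families `ε`-sharp off `o(N)`
particles (the relaxed-hcp numbers `a* ≈ 0.971 ∈ [19/20, 1]`, `h* ≈ 0.793 ≥ 19/25` fit the constants).
Why it might fail: residual bulk strain `≥ ε` forced at positive density by the long-range fields of
the `o(N)` defects, or relaxed inter-layer gaps below `19/25` / bonds below `19/20` under the finite-`N`
Laplace compression.  Leans on: `LennardJonesMinimalDistance_holds`, `HalesDSP_layerPackings_holds`,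
`softLayerPropagation` (BrittleRungDescent, PROVED), Blanc–Lewin 2015 §2, arXiv:1504.01153. -/
theorem stub_goodWindows : Summit.AtomisticToContinuum.Crystallization.Theses.TwoCentreKissingKernel.LocalClosePacking → ∀ R ε : ℝ, 2 ≤ R → 0 < ε → ∀ x : (N : ℕ) → (Fin N → EuclideanSpace ℝ (Fin 3)), (∀ N, Literature.MathematicalPhysics.StatisticalMechanics.IsGroundState Literature.MathematicalPhysics.StatisticalMechanics.lennardJones (x N)) → Filter.Tendsto (fun N : ℕ => (Nat.card {i : Fin N // ¬ (∃ a b : ℝ, 19 / 20 ≤ a ∧ a ≤ 1 ∧ 19 / 20 ≤ b ∧ b ≤ 1 ∧ ∃ n : EuclideanSpace ℝ (Fin 3), ‖n‖ = 1 ∧ ∃ c : ℤ → ℝ, (∀ k : ℤ, c k + 19 / 25 ≤ c (k + 1)) ∧ ∃ l : Fin N → ℤ, (∀ j : Fin N, dist (x N j) (x N i) ≤ R → |inner ℝ (x N j - x N i) n - c (l j)| ≤ ε) ∧ (∀ j k : Fin N, dist (x N j) (x N i) ≤ R → dist (x N k) (x N i) ≤ R → j ≠ k → 19 / 20 ≤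 dist (x N j) (x N k)) ∧ ∀ j : Fin N, dist (x N j) (x N i) ≤ R / 2 → Nat.card {k : Fin N // k ≠ j ∧ l k = l j ∧ dist (x N j) (x N k) ≤ 1} = 6 ∧ Nat.card {k : Fin N // l k = l j + 1 ∧ dist (x N j) (x N k) ≤ 1} = 3 ∧ Nat.card {k : Fin N // l k = l j - 1 ∧ dist (x N j) (x N k) ≤ 1} = 3 ∧ ∀ k : Fin N, k ≠ j → dist (x N j) (x N k) ≤ 1 → (l k = l j → |dist (x N j) (x N k) - a| ≤ ε) ∧ (l k ≠ l j → |dist (x N j) (x N k) - b| ≤ ε))} : ℝ) / N) Filter.atTop (nhds 0) := by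
  sorry

/-- **Stub 2 — LAMINAR RIGIDITY** (= crux `LaminarSixThreeThree.LaminarRigidity`, stmt-14295, SHARED
verbatim; pure geometry, no potential; size L): some `C : ℝ → ℝ` such that for `R ≥ 16`,
`0 < ε ≤ 1/1000`, every GOOD `(R, ε)`-window of any finite configuration is two-way `C R * ε`-matched
on radius `R/4`, after a rigid motion, to `barlowStacking a h s` for some `a, h ∈ (1/2, 2)` and Hägg
`s` (hexagonal rings by angle bookkeeping, up-triples occupy alternate faces, one Hägg letter per
layer pair; discrete Friesecke–James–Müller).  Why it might fail: one GOOD window not `O(ε)`-Barlow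
on `R/4`.  Leans on: `IsTwelveConfig.eq_layerShell`, `exists_barlowStacking_subset` (tree), HalesDSP2012,
FrieseckeJamesMuller2002. -/
theorem stub_rigidity : Summit.AtomisticToContinuum.Crystallization.Theses.LaminarSixThreeThree.LaminarRigidity := by
  sorry

/-- **Stub 3 — STACKING SELECTION** (ENERGY II; the hinge's proper content; size XL / open):
`LaminarBarlowWindows → StackingFaultSparsity` — if along every sequence of LJ ground states a.e.
particle has, at every scale `(R, ε)`, a window matched to SOME Barlow stacking, then the particles
matched to some Barlow stacking but to NO `hcpStacking a h` are `o(N)` at every `(R, ε)`.  Mechanism: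
each misaligned layer pair crossing the bulk costs `≥ (|J₂| − Σ_{k≥3} k|J_k|)·area > 0` (Hägg
domination with certified interlayer couplings, summit items 0716 / 0737 / 0670) against the
`O(N^{2/3})` surface budget, so `O(1)` fault planes meet `o(N)` windows; alternative: truncation +
periodicity of 1-D finite-range ground states (Radin–Schulman 1983).  Why it might fail: hcp must
beat every stacking extensively (`J₂ ≈ −7.3e−5`, uncertified); an aperiodic or fcc-rich optimal LJ
stacking kills it.  Disproof used (crux 14296): keeps `IsGroundState`
(`stackingFaultSparsity_false_without_groundState`), is not the refuted `SameScaleBarlowToHcp`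
(all-scale hypothesis, ground states only).  Weaker than the shared item stmt-14296 (its consequent). -/
theorem stub_stackingSelection : Summit.AtomisticToContinuum.Crystallization.Theses.LaminarSixThreeThree.LaminarBarlowWindows → Summit.AtomisticToContinuum.Crystallization.Theses.LaminarSixThreeThree.StackingFaultSparsity := by
  sorry

/-- Sanity: the registered signature of stub 1 is `ClosePackedGoodWindows` (definitional unfolding). -/
theorem stub_goodWindows_iff : (Summit.AtomisticToContinuum.Crystallization.Theses.TwoCentreKissingKernel.LocalClosePacking → ∀ R ε : ℝ, 2 ≤ R → 0 < ε → ∀ x : (N : ℕ) → (Fin N → EuclideanSpace ℝ (Fin 3)), (∀ N, Literature.MathematicalPhysics.StatisticalMechanics.IsGroundState Literature.MathematicalPhysics.StatisticalMechanics.lennardJones (x N)) → Filter.Tendsto (fun N : ℕ => (Nat.card {i : Fin N // ¬ (∃ a b : ℝ, 19 / 20 ≤ a ∧ a ≤ 1 ∧ 19 / 20 ≤ b ∧ b ≤ 1 ∧ ∃ n : EuclideanSpace ℝ (Fin 3), ‖n‖ = 1 ∧ ∃ c : ℤ → ℝ, (∀ k : ℤ, c k + 19 / 25 ≤ c (k +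 1)) ∧ ∃ l : Fin N → ℤ, (∀ j : Fin N, dist (x N j) (x N i) ≤ R → |inner ℝ (x N j - x N i) n - c (l j)| ≤ ε) ∧ (∀ j k : Fin N, dist (x N j) (x N i) ≤ R → dist (x N k) (x N i) ≤ R → j ≠ k → 19 / 20 ≤ dist (x N j) (x N k)) ∧ ∀ j : Fin N, dist (x N j) (x N i) ≤ R / 2 → Nat.card {k : Fin N // k ≠ j ∧ l k = l j ∧ dist (x N j) (x N k) ≤ 1} = 6 ∧ Nat.card {k : Fin N // l k = l j + 1 ∧ dist (x N j) (x N k) ≤ 1} = 3 ∧ Nat.card {k : Fin N // l k = l j - 1 ∧ dist (x N j) (x N k) ≤ 1} = 3 ∧ ∀ k : Fin N, k ≠ j → dist (x N j) (x N k) ≤ 1 → (l k = l j → |dist (x N j) (x N k) - a| ≤ ε) ∧ (l k ≠ l j → |dist (x N j) (x N k) - b| ≤ ε))} : ℝ) / N) Filter.atTop (nhds 0)) ↔ ClosePackedGoodWindows :=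
  Iff.rfl

/-- Sanity: the registered signature of stub 3 is `StackingSelection`. -/
theorem stub_stackingSelection_iff : (Summit.AtomisticToContinuum.Crystallization.Theses.LaminarSixThreeThree.LaminarBarlowWindows → Summit.AtomisticToContinuum.Crystallization.Theses.LaminarSixThreeThree.StackingFaultSparsity) ↔ StackingSelection :=
  Iff.rfl

/-! ## Composition (sorry-free) -/

/-- Arithmetic of the tolerances (the landed `laminarToBarlow_tolerance`): with
`ε' = min (ε / max c 1) (1/1000)` and `0 < ε` one has `0 < ε'`, `ε' ≤ 1/1000` and `c * ε' ≤ ε`. -/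
theorem tolerance_aux (c ε : ℝ) (hε : 0 < ε) :
    0 < min (ε / max c 1) (1 / 1000) ∧ min (ε / max c 1) (1 / 1000) ≤ 1 / 1000 ∧
      c * min (ε / max c 1) (1 / 1000) ≤ ε :=
  laminarToBarlow_tolerance c ε hε

/-- Monotonicity of Barlow matching in radius and tolerance. -/
theorem barlowMatched_mono {R R' δ δ' : ℝ} {N : ℕ} {x : Fin N → E3} {i : Fin N}
    (hR : R ≤ R') (hδ : δ' ≤ δ) (h : BarlowMatched R' δ' x i) : BarlowMatched R δ x i := by
  obtain ⟨a, h, ha1, ha2, hh1, hh2, s, hs, z, hz, A, hA1, hA2⟩ := h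
  refine ⟨a, h, ha1, ha2, hh1, hh2, s, hs, z, hz, A, ?_, ?_⟩
  · intro p hp hpz
    obtain ⟨j, hj⟩ := hA1 p hp (hpz.trans hR)
    exact ⟨j, hj.trans hδ⟩
  · intro j hj
    obtain ⟨p, hp, hpj⟩ := hA2 j (hj.trans hR)
    exact ⟨p, hp, hpj.trans hδ⟩

/-- **GOOD windows a.e. + laminar rigidity ⇒ Barlow windows a.e.** (the conclusion is
`LaminarBarlowWindows` spelled through `BarlowMatched`, see `barlowWindows_iff`): at `(R, ε)` invoke
good windows at `R' = max (4R) 16`, `ε' = min (ε / max (C R') 1) (1/1000)` and rigidity at `(R', ε')`;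
`barlowMatched_mono` (`R ≤ R'/4`, `C R' * ε' ≤ ε`) puts the bad set of the conclusion inside the
non-GOOD set for every `N`; `Nat.card` comparison and `squeeze_zero` (the argument of the landed
`laminarToBarlow_proof`, restated from its weakest hypothesis). -/
theorem barlowWindows_of_goodWindows (hGood : GoodWindowsAE) (hRig : LaminarRigidity) :
    ∀ R ε : ℝ, 0 < R → 0 < ε → ε < 1 / 4 → ∀ x : (N : ℕ) → (Fin N → E3),
      (∀ N, IsGroundState lennardJones (x N)) →
        Filter.Tendsto (fun N : ℕ => (Nat.card {i : Fin N // ¬ BarlowMatched R ε (x N) i} : ℝ) / N)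
          Filter.atTop (nhds 0) := by
  intro R ε hR hε _hε4 x hx
  obtain ⟨C, hC⟩ := (rigidity_iff.mp hRig)
  -- the radius and tolerance at which good windows and rigidity are invoked
  set R' : ℝ := max (4 * R) 16 with hR'def
  have hR'16 : (16 : ℝ) ≤ R' := le_max_right _ _
  have hR'2 : (2 : ℝ) ≤ R' := le_trans (by norm_num) hR'16
  have hRR' : R ≤ R' / 4 := by
    have h4 : 4 * R ≤ R' := le_max_left _ _
    linarith
  obtain ⟨hε'pos, hε'le, hCε'⟩ := tolerance_aux (C R') ε hε
  set ε' : ℝ := min (ε / max (C R') 1) (1 / 1000) with hε'def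
  -- good windows: the fraction of particles without a GOOD (R', ε')-window tends to zero
  have hT := hGood R' ε' hR'2 hε'pos x hx
  refine squeeze_zero (fun N => ?_) (fun N => ?_) hT
  · positivity
  · refine div_le_div_of_nonneg_right (Nat.cast_le.mpr ?_) (Nat.cast_nonneg N)
    -- the bad set of the conclusion lies inside the non-GOOD set
    refine Nat.card_le_card_of_injective
      (Subtype.map id fun i hi hgood => hi ?_) (Subtype.map_injective _ Function.injective_id)
    -- rigidity: a GOOD (R', ε')-window is Barlow-matched at (R' / 4, C R' * ε'), hence at (R, ε)
    exact barlowMatched_mono hRR' hCε' (hC R' ε' hR'16 hε'pos hε'le N (x N) i hgood)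

/-- Hence `LaminarBarlowWindows` (Barlow windows a.e., all scales) from GOOD windows a.e. and laminar
rigidity. -/
theorem laminarBarlowWindows_of_goodWindows (hGood : GoodWindowsAE) (hRig : LaminarRigidity) :
    LaminarBarlowWindows :=
  barlowWindows_iff.mpr (barlowWindows_of_goodWindows hGood hRig)

/-- **Barlow windows a.e. + stacking selection ⇒ conjunct (ii)**, through the three PROVED glues of
`LaminarSixThreeThree`: counting (`barlowToHcpWindows_proof`: eventually an hcp window), compactness
(`hcpWindowsToPeriodicWindows_proof`: one periodic configuration frequently matched) and the hull
criterion (`HullCriterion_holds`: periodic windows ⇒ `IsCrystallizing`, with the PROVED LJ minimal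
distance). -/
theorem isCrystallizing_of_barlowWindows (hX : LaminarBarlowWindows) (hSel : StackingSelection) :
    IsCrystallizing lennardJones 3 :=
  HullCriterion_holds (hcpWindowsToPeriodicWindows_proof (barlowToHcpWindows_proof hX (hSel hX)))

/-- The composition over the named statements, concluding the BODY of the crux
(`LocalClosePacking → IsCrystallizing lennardJones 3`): close-packed good windows, laminar rigidity and
stacking selection give the hinge. -/
theorem isCrystallizing_of_named (hGood : ClosePackedGoodWindows) (hRig : LaminarRigidity)
    (hSel : StackingSelection) : LocalClosePacking → IsCrystallizing lennardJones 3 :=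
  fun hL => isCrystallizing_of_barlowWindows (laminarBarlowWindows_of_goodWindows (hGood hL) hRig) hSel

/-- **Composition with explicit hypotheses `ClosePackedCrystallizes_of_stubs`** (sorry-free; pure logic over
the landed glues): the three registered stubs' STATEMENTS, verbatim, imply the body of the crux verbatim
(`TwoCentreKissingKernel.LocalClosePacking → IsCrystallizing lennardJones 3`, i.e. `ClosePackedCrystallizes`
unfolded — see `crux_iff`).  This is the `stub₁ → stub₂ → stub₃ → crux` implication of the registration
contract; the by-name form is `ClosePackedCrystallizes_of` below (the `ledger skeleton check` shape: no
hypotheses, `sorry` only inside `stub_*`). -/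
theorem ClosePackedCrystallizes_of_stubs :
    (Summit.AtomisticToContinuum.Crystallization.Theses.TwoCentreKissingKernel.LocalClosePacking → ∀ R ε : ℝ, 2 ≤ R → 0 < ε → ∀ x : (N : ℕ) → (Fin N → EuclideanSpace ℝ (Fin 3)), (∀ N, Literature.MathematicalPhysics.StatisticalMechanics.IsGroundState Literature.MathematicalPhysics.StatisticalMechanics.lennardJones (x N)) → Filter.Tendsto (fun N : ℕ => (Nat.card {i : Fin N // ¬ (∃ a b : ℝ, 19 / 20 ≤ a ∧ a ≤ 1 ∧ 19 / 20 ≤ b ∧ b ≤ 1 ∧ ∃ n : EuclideanSpace ℝ (Fin 3), ‖n‖ = 1 ∧ ∃ c : ℤ → ℝ, (∀ k : ℤ, c k + 19 / 25 ≤ c (k + 1)) ∧ ∃ l : Fin N → ℤ, (∀ j : Fin N, dist (x N j) (x N i) ≤ R → |inner ℝ (x N j - x N i) n - c (l j)| ≤ ε) ∧ (∀ j k : Fin N, dist (x N j) (x N i) ≤ R → dist (x N k) (x N i) ≤ R → j ≠ k → 19 / 20 ≤ dist (x N j) (x N k)) ∧ ∀ j : Fin N, dist (x N j) (x N i) ≤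 R / 2 → Nat.card {k : Fin N // k ≠ j ∧ l k = l j ∧ dist (x N j) (x N k) ≤ 1} = 6 ∧ Nat.card {k : Fin N // l k = l j + 1 ∧ dist (x N j) (x N k) ≤ 1} = 3 ∧ Nat.card {k : Fin N // l k = l j - 1 ∧ dist (x N j) (x N k) ≤ 1} = 3 ∧ ∀ k : Fin N, k ≠ j → dist (x N j) (x N k) ≤ 1 → (l k = l j → |dist (x N j) (x N k) - a| ≤ ε) ∧ (l k ≠ l j → |dist (x N j) (x N k) - b| ≤ ε))} : ℝ) / N) Filter.atTop (nhds 0)) →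
    (Summit.AtomisticToContinuum.Crystallization.Theses.LaminarSixThreeThree.LaminarRigidity) →
    (Summit.AtomisticToContinuum.Crystallization.Theses.LaminarSixThreeThree.LaminarBarlowWindows → Summit.AtomisticToContinuum.Crystallization.Theses.LaminarSixThreeThree.StackingFaultSparsity) →
    (Summit.AtomisticToContinuum.Crystallization.Theses.TwoCentreKissingKernel.LocalClosePacking → Literature.MathematicalPhysics.StatisticalMechanics.IsCrystallizing Literature.MathematicalPhysics.StatisticalMechanics.lennardJones 3) :=
  fun hGood hRig hSel => isCrystallizing_of_named hGood hRig hSel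

/-- **SKELETON THEOREM `ClosePackedCrystallizes_of` — the crux BY NAME from the three registered stubs**
(the only theorem of this file concluding `TwoCentreKissingKernel.ClosePackedCrystallizes`; no hypotheses;
its only `sorry`s are the ones inside `stub_goodWindows`, `stub_rigidity`, `stub_stackingSelection`). -/
theorem ClosePackedCrystallizes_of :
    Summit.AtomisticToContinuum.Crystallization.Theses.TwoCentreKissingKernel.ClosePackedCrystallizes :=
  crux_iff.mpr (ClosePackedCrystallizes_of_stubs stub_goodWindows stub_rigidity stub_stackingSelection)

end Summit.AtomisticToContinuum.Crystallization.Cruxes.ClosePackedCrystallizes.Birth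

end
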